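import Mathlib.LinearAlgebra.Matrix.Determinant.Basic
import Mathlib.Data.ZMod.Basic
import Mathlib.Data.Real.Basic
import Mathlib.Algebra.Order.BigOperators.Group.Finset
import Mathlib.Tactic.Linarith
import Mathlib.Tactic.Ring
import HarnessLib

/-!
# `NoHeavyLowerTail` (crux stmt-CriticalPhenomena-4575), P2 — THE CHAIN LEMMA: the matching lemma `M′` behind `G3` via a parity argument over `GF(2)`

Memo SAHI-ROUTE.md §4.30–§4.31 / `G3-REDUCTIONS-PROOFS.md` §6 (seat `prim-masterthm-p2`, gen 9; `--supports stmt-CriticalPhenomena-4575`).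
No `sorry`, standard axioms.

CONTEXT.  THEOREM B of §4.29 (the hybrid certificate for Kahn's `C_3` on cubes) needs the Φ-positivity statement `G3`; by the orbit
reduction and the antipodal reduction (file `…SahiAntipodalReduction`, `antipodalSum_nonneg_of_matching`) `G3` for product weights on all
cubes follows from the MATCHING LEMMA `M′`: for every up-set `U ⊆ 2^[k]` and increasing `F, H ≥ 0` there is a bijection `v : U → Ū`
(`Ū = {[k] ∖ u}`) with `v u ⊆ u` and `Σ_{u∈U} F(v u)·H(u) ≥ Σ_{u∈U} F([k]∖u)·H(u)`.  THIS FILE proves the combinatorial core in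
SEQUENCE FORM.  Let `c 0, c 1, …, c (m-1)` enumerate `U` along a linear extension (`c t ⊆ c s → t ≤ s`).  We construct
`p 0, …, p (m-1) ∈ U`, pairwise distinct, with `(c t)ᶜ ⊆ p t` and such that for every `t ≤ m` the prefix `{c 0..c (t-1)}` is matched
into `{p 0..p (t-1)}` by a permutation `σ` with `c (σ j) ⊆ p j` (`exists_chain`).  With `v (p t) := (c t)ᶜ` this is the matching of
`M′`, and Abel summation gives the inequality (`chain_sum_le`) for every `H` monotone and every `F` with `t ↦ F (c t)ᶜ` antitone and
nonnegative — i.e. for the enumeration chosen compatible with `F`.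

THE PROOF (new): strengthen "the prefix is matched" to "the containment matrix `Z_t = (1[c s ⊆ p j])_{s,j<t}` has determinant `1`
over `ZMod 2`" (`det ≠ 0` exhibits a permutation with all entries `1`, `exists_dominating_perm`).  ONE-STEP LEMMA
(`sum_det_zetaMat_update`): if `det Z_t(p) = 1` then `Σ_{u ∈ U, (c t)ᶜ ⊆ u} det Z_{t+1}(p with p t := u) = det Z_t(p) = 1`:
the sum is the determinant with last column `Σ_u w_u`, whose `s`-th entry counts `{u : (c t)ᶜ ∪ c s ⊆ u}` — a full cube of size
`2^{|c t ∖ c s|}` because `U` is an up-set containing `c s` — hence is `1` exactly at `s = t` (linear extension); Laplace along the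
last column.  So some admissible `u` keeps the determinant equal to `1` (`exists_good_cover`), the chain is built by induction
(`exists_gf2_chain`), and distinctness is automatic (a repeated column kills the determinant).
-/

noncomputable section

open scoped Classical

namespace Summit.CriticalPhenomena.PercolationContinuityZ3.Theorems

namespace SahiSharedCube

open Finset Matrix

variable {k : ℕ}

/-! ## The containment matrix over `ZMod 2` -/

/- Throughout, the containment ("zeta") matrix `Z_t(q) = (1[c s ⊆ q j])_{s,j<t}` over `ZMod 2` is written out as
`Matrix.of fun (s j : Fin t) => if c s ⊆ q j then 1 else 0`, and the column vector `w_u = (1[c s ⊆ u])_{s<t}` as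
`fun s : Fin t => if c s ⊆ u then 1 else 0` (no auxiliary definitions). -/

/-- `Z_t(q)` only depends on `q 0, …, q (t-1)`. [this work] -/
theorem zetaMat_congr {c q q' : ℕ → Finset (Fin k)} {t : ℕ} (h : ∀ j < t, q j = q' j) :
    (Matrix.of fun (s : Fin (t)) (j : Fin (t)) => if c (s : ℕ) ⊆ (q) (j : ℕ) then (1 : ZMod 2) else 0) = (Matrix.of fun (s : Fin (t)) (j : Fin (t)) => if c (s : ℕ) ⊆ (q') (j : ℕ) then (1 : ZMod 2) else 0) := by
  ext s j
  simp only [Matrix.of_apply, h j j.isLt]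

/-- Replacing `q t` by `u` replaces the last column of `Z_{t+1}` by `w_u`. [this work] -/
theorem zetaMat_update (c q : ℕ → Finset (Fin k)) (t : ℕ) (u : Finset (Fin k)) :
    (Matrix.of fun (s : Fin (t + 1)) (j : Fin (t + 1)) => if c (s : ℕ) ⊆ (Function.update q t u) (j : ℕ) then (1 : ZMod 2) else 0) = ((Matrix.of fun (s : Fin (t + 1)) (j : Fin (t + 1)) => if c (s : ℕ) ⊆ (q) (j : ℕ) then (1 : ZMod 2) else 0)).updateCol (Fin.last t) (fun s : Fin (t + 1) => if c (s : ℕ) ⊆ u then (1 : ZMod 2) else 0) := by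
  ext s j
  by_cases hj : j = Fin.last t
  · subst hj
    simp only [Matrix.of_apply, Matrix.updateCol_self, Fin.val_last, Function.update_self]
  · have hjt : (j : ℕ) ≠ t := fun h => hj (Fin.ext (by rw [h, Fin.val_last]))
    simp only [Matrix.of_apply, Matrix.updateCol_ne hj, Function.update_of_ne hjt]

/-- The upper-left block of `Z_{t+1}(q)` with the last column replaced is `Z_t(q)`. [this work] -/
theorem zetaMat_submatrix_castSucc (c q : ℕ → Finset (Fin k)) (t : ℕ) (v : Fin (t + 1) → ZMod 2) :
    (((Matrix.of fun (s : Fin (t + 1)) (j : Fin (t + 1)) => if c (s : ℕ) ⊆ (q) (j : ℕ) then (1 : ZMod 2) else 0)).updateCol (Fin.last t) v).submatrix Fin.castSucc Fin.castSucc = (Matrix.of fun (s : Fin (t)) (j : Fin (t)) => if c (s : ℕ) ⊆ (q) (j : ℕ) then (1 : ZMod 2) else 0) := by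
  ext s j
  rw [Matrix.submatrix_apply, Matrix.updateCol_ne (Fin.castSucc_lt_last j).ne, Matrix.of_apply, Matrix.of_apply,
    Fin.val_castSucc, Fin.val_castSucc]

/-- Additivity of the determinant in one column, `Finset` version. [folklore] -/
theorem det_updateCol_finsetSum {n : Type*} [Fintype n] [DecidableEq n] {R : Type*} [CommRing R] {ι : Type*}
    (A : Matrix n n R) (j : n) (s : Finset ι) (v : ι → n → R) :
    ∑ i ∈ s, (A.updateCol j (v i)).det = (A.updateCol j (∑ i ∈ s, v i)).det := by
  induction s using Finset.induction_on with
  | empty =>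
    simp only [Finset.sum_empty]
    exact (Matrix.det_eq_zero_of_column_eq_zero j fun i => by simp).symm
  | insert a s ha ih =>
    rw [Finset.sum_insert ha, Finset.sum_insert ha, Matrix.det_updateCol_add, ih]

/-- The supersets of `a` in `2^[k]` are `2^{|aᶜ|}` in number. [folklore] -/
theorem card_filter_superset (a : Finset (Fin k)) :
    (Finset.univ.filter fun u : Finset (Fin k) => a ⊆ u).card = 2 ^ aᶜ.card := by
  have hset : (Finset.univ.filter fun u : Finset (Fin k) => a ⊆ u) = (aᶜ.powerset).image fun v => a ∪ v := by
    ext u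
    simp only [Finset.mem_filter, Finset.mem_univ, true_and, Finset.mem_image, Finset.mem_powerset]
    constructor
    · intro h
      refine ⟨u \ a, fun x hx => ?_, Finset.union_sdiff_of_subset h⟩
      rw [Finset.mem_compl]
      exact (Finset.mem_sdiff.1 hx).2
    · rintro ⟨v, -, rfl⟩
      exact Finset.subset_union_left
  rw [hset, Finset.card_image_of_injOn, Finset.card_powerset]
  intro v hv v' hv' h
  have hv : v ⊆ aᶜ := Finset.mem_powerset.1 hv
  have hv' : v' ⊆ aᶜ := Finset.mem_powerset.1 hv'
  have hd : Disjoint a v := Finset.disjoint_left.2 fun x hxa hxv => by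
    have := hv hxv; rw [Finset.mem_compl] at this; exact this hxa
  have hd' : Disjoint a v' := Finset.disjoint_left.2 fun x hxa hxv => by
    have := hv' hxv; rw [Finset.mem_compl] at this; exact this hxa
  have h' : a ∪ v = a ∪ v' := by simpa using h
  calc v = (a ∪ v) \ a := (Finset.union_sdiff_cancel_left hd).symm
    _ = (a ∪ v') \ a := by rw [h']
    _ = v' := Finset.union_sdiff_cancel_left hd'

/-- In `ZMod 2`, `2^n` is `1` for `n = 0` and `0` otherwise. [folklore] -/
theorem natCast_two_pow_zmod_two (n : ℕ) : ((2 ^ n : ℕ) : ZMod 2) = if n = 0 then 1 else 0 := by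
  split_ifs with h
  · simp [h]
  · rw [Nat.cast_pow]
    have h2 : ((2 : ℕ) : ZMod 2) = 0 := by decide
    rw [h2, zero_pow h]

/-! ## The one-step lemma -/

section chain

/- Standing hypotheses (passed explicitly): `hup` — `U` is an up-set; `hmem` — `c 0, …, c (m-1) ∈ U`;
`hlin` — `c` is a linear extension (hence injective) on `[0, m)`: `c t ⊆ c s → t ≤ s`. -/
variable {U : Finset (Finset (Fin k))} {c : ℕ → Finset (Fin k)} {m : ℕ}

/-- The column sum `Σ_{u ∈ U, (c t)ᶜ ⊆ u} w_u` is the last basis vector: its `s`-th entry counts the supersets of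
`(c t)ᶜ ∪ c s`, all of which lie in the up-set `U ∋ c s`; there are `2^{|c t ∖ c s|}` of them, odd iff `c t ⊆ c s` iff `s = t`. [this work] -/
theorem sum_wvec_eq_single (hup : ∀ ⦃x y : Finset (Fin k)⦄, x ∈ U → x ⊆ y → y ∈ U)
    (hmem : ∀ s < m, c s ∈ U) (hlin : ∀ s t, s < m → t < m → c t ⊆ c s → t ≤ s) {t : ℕ} (ht : t < m) :
    ∑ u ∈ U.filter (fun u => (c t)ᶜ ⊆ u), (fun s : Fin (t + 1) => if c (s : ℕ) ⊆ u then (1 : ZMod 2) else 0) = Pi.single (Fin.last t) 1 := by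
  ext s
  have hs : (s : ℕ) < m := lt_of_le_of_lt (Nat.lt_succ_iff.1 s.isLt) ht
  rw [Finset.sum_apply, Finset.sum_boole, Finset.filter_filter]
  -- the double filter is the set of all supersets of `a := (c t)ᶜ ∪ c s`
  have hfilt : (U.filter fun u => (c t)ᶜ ⊆ u ∧ c ↑s ⊆ u) =
      Finset.univ.filter fun u : Finset (Fin k) => (c t)ᶜ ∪ c s ⊆ u := by
    ext u
    simp only [Finset.mem_filter, Finset.mem_univ, true_and, Finset.union_subset_iff]
    constructor
    · exact fun hu => hu.2
    · exact fun hu => ⟨hup (hmem s hs) hu.2, hu⟩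
  rw [hfilt, card_filter_superset, natCast_two_pow_zmod_two]
  have hcompl : ((c t)ᶜ ∪ c ↑s)ᶜ.card = 0 ↔ c t ⊆ c s := by
    rw [Finset.card_eq_zero, Finset.compl_union, compl_compl, ← Finset.sdiff_eq_inter_compl,
      Finset.sdiff_eq_empty_iff_subset]
  by_cases hst : s = Fin.last t
  · subst hst
    have : c t ⊆ c ↑(Fin.last t) := by rw [Fin.val_last]
    rw [if_pos (hcompl.2 this), Pi.single_eq_same]
  · have hlt : (s : ℕ) < t := by
      rcases lt_or_eq_of_le (Nat.lt_succ_iff.1 s.isLt) with h1 | h1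
      · exact h1
      · exact absurd (Fin.ext (by rw [h1, Fin.val_last])) hst
    have hns : ¬ c t ⊆ c ↑s := fun hsub => absurd (hlin s t hs ht hsub) (not_le.2 hlt)
    rw [if_neg (mt hcompl.1 hns), Pi.single_eq_of_ne hst]

/-- **One-step lemma (determinant form).**  `Σ_{u ∈ U, (c t)ᶜ ⊆ u} det Z_{t+1}(q[t ↦ u]) = det Z_t(q)` in `ZMod 2`. [this work] -/
theorem sum_det_zetaMat_update (hup : ∀ ⦃x y : Finset (Fin k)⦄, x ∈ U → x ⊆ y → y ∈ U)
    (hmem : ∀ s < m, c s ∈ U) (hlin : ∀ s t, s < m → t < m → c t ⊆ c s → t ≤ s) (q : ℕ → Finset (Fin k)) {t : ℕ} (ht : t < m) :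
    ∑ u ∈ U.filter (fun u => (c t)ᶜ ⊆ u), ((Matrix.of fun (s : Fin (t + 1)) (j : Fin (t + 1)) => if c (s : ℕ) ⊆ (Function.update q t u) (j : ℕ) then (1 : ZMod 2) else 0)).det = ((Matrix.of fun (s : Fin (t)) (j : Fin (t)) => if c (s : ℕ) ⊆ (q) (j : ℕ) then (1 : ZMod 2) else 0)).det := by
  simp_rw [zetaMat_update]
  rw [det_updateCol_finsetSum, sum_wvec_eq_single hup hmem hlin ht, Matrix.det_succ_column _ (Fin.last t),
    Finset.sum_eq_single (Fin.last t)]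
  · have h1 : (-1 : ZMod 2) ^ ((Fin.last t : ℕ) + (Fin.last t : ℕ)) = 1 := by
      have : (-1 : ZMod 2) = 1 := by decide
      rw [this, one_pow]
    rw [h1, one_mul, Matrix.updateCol_self, Pi.single_eq_same, one_mul, Fin.succAbove_last,
      zetaMat_submatrix_castSucc]
  · intro i _ hi
    rw [Matrix.updateCol_self, Pi.single_eq_of_ne hi, mul_zero, zero_mul]
  · intro hn
    exact absurd (Finset.mem_univ _) hn

/-- **One-step lemma (existence form).**  If `det Z_t(q) = 1` then some `u ∈ U` with `(c t)ᶜ ⊆ u` keeps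
`det Z_{t+1}(q[t ↦ u]) = 1` (the number of such `u` is odd). [this work] -/
theorem exists_good_cover (hup : ∀ ⦃x y : Finset (Fin k)⦄, x ∈ U → x ⊆ y → y ∈ U)
    (hmem : ∀ s < m, c s ∈ U) (hlin : ∀ s t, s < m → t < m → c t ⊆ c s → t ≤ s) (q : ℕ → Finset (Fin k)) {t : ℕ} (ht : t < m)
    (hdet : ((Matrix.of fun (s : Fin (t)) (j : Fin (t)) => if c (s : ℕ) ⊆ (q) (j : ℕ) then (1 : ZMod 2) else 0)).det = 1) :
    ∃ u ∈ U, (c t)ᶜ ⊆ u ∧ ((Matrix.of fun (s : Fin (t + 1)) (j : Fin (t + 1)) => if c (s : ℕ) ⊆ (Function.update q t u) (j : ℕ) then (1 : ZMod 2) else 0)).det = 1 := by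
  have hsum := sum_det_zetaMat_update hup hmem hlin q ht
  rw [hdet] at hsum
  have hne : ∑ u ∈ U.filter (fun u => (c t)ᶜ ⊆ u), ((Matrix.of fun (s : Fin (t + 1)) (j : Fin (t + 1)) => if c (s : ℕ) ⊆ (Function.update q t u) (j : ℕ) then (1 : ZMod 2) else 0)).det ≠ 0 := by
    rw [hsum]; exact one_ne_zero
  obtain ⟨u, hu, hu'⟩ := Finset.exists_ne_zero_of_sum_ne_zero hne
  rw [Finset.mem_filter] at hu
  have h01 : ∀ x : ZMod 2, x ≠ 0 → x = 1 := by decide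
  exact ⟨u, hu.1, hu.2, h01 _ hu'⟩

/-! ## The chain -/

/-- **`GF(2)`-chain.**  There is `p` with `p t ∈ U`, `(c t)ᶜ ⊆ p t` (`t < m`) and `det Z_t(p) = 1` for every `t ≤ m`. [this work] -/
theorem exists_gf2_chain (hup : ∀ ⦃x y : Finset (Fin k)⦄, x ∈ U → x ⊆ y → y ∈ U)
    (hmem : ∀ s < m, c s ∈ U) (hlin : ∀ s t, s < m → t < m → c t ⊆ c s → t ≤ s) :
    ∃ p : ℕ → Finset (Fin k), (∀ t < m, p t ∈ U ∧ (c t)ᶜ ⊆ p t) ∧ ∀ t ≤ m, ((Matrix.of fun (s : Fin (t)) (j : Fin (t)) => if c (s : ℕ) ⊆ (p) (j : ℕ) then (1 : ZMod 2) else 0)).det = 1 := by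
  suffices hmain : ∀ n ≤ m, ∃ p : ℕ → Finset (Fin k),
      (∀ t < n, p t ∈ U ∧ (c t)ᶜ ⊆ p t) ∧ ∀ t ≤ n, ((Matrix.of fun (s : Fin (t)) (j : Fin (t)) => if c (s : ℕ) ⊆ (p) (j : ℕ) then (1 : ZMod 2) else 0)).det = 1 from hmain m le_rfl
  intro n
  induction n with
  | zero =>
    intro _
    refine ⟨fun _ => ∅, fun t ht => absurd ht (Nat.not_lt_zero t), fun t ht => ?_⟩
    obtain rfl := Nat.le_zero.1 ht
    exact Matrix.det_isEmpty
  | succ n ih =>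
    intro hn
    obtain ⟨p, hp1, hp2⟩ := ih (Nat.le_of_succ_le hn)
    have hnm : n < m := Nat.lt_of_succ_le hn
    obtain ⟨u, huU, huc, hdet⟩ := exists_good_cover hup hmem hlin p hnm (hp2 n le_rfl)
    refine ⟨Function.update p n u, fun t ht => ?_, fun t ht => ?_⟩
    · rcases Nat.lt_succ_iff_lt_or_eq.1 ht with hlt | rfl
      · rw [Function.update_of_ne (Nat.ne_of_lt hlt)]
        exact hp1 t hlt
      · rw [Function.update_self]
        exact ⟨huU, huc⟩
    · rcases Nat.lt_or_eq_of_le ht with hlt | rfl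
      · have hle : t ≤ n := Nat.lt_succ_iff.1 hlt
        rw [zetaMat_congr (q := Function.update p n u) (q' := p) fun j hj =>
          Function.update_of_ne (Nat.ne_of_lt (lt_of_lt_of_le hj hle)) u p]
        exact hp2 t hle
      · exact hdet

/-- `det Z_t(q) ≠ 0` exhibits a permutation `σ` of the prefix with `c (σ j) ⊆ q j` for all `j < t`. [this work] -/
theorem exists_dominating_perm (c q : ℕ → Finset (Fin k)) (t : ℕ) (hdet : ((Matrix.of fun (s : Fin (t)) (j : Fin (t)) => if c (s : ℕ) ⊆ (q) (j : ℕ) then (1 : ZMod 2) else 0)).det ≠ 0) :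
    ∃ σ : Equiv.Perm (Fin t), ∀ j : Fin t, c (σ j) ⊆ q j := by
  rw [Matrix.det_apply] at hdet
  obtain ⟨σ, -, hσ⟩ := Finset.exists_ne_zero_of_sum_ne_zero hdet
  refine ⟨σ, fun j => ?_⟩
  by_contra hc
  apply hσ
  have hzero : ∏ i, ((Matrix.of fun (s : Fin (t)) (j : Fin (t)) => if c (s : ℕ) ⊆ (q) (j : ℕ) then (1 : ZMod 2) else 0)) (σ i) i = 0 :=
    Finset.prod_eq_zero (Finset.mem_univ j) (by simp [hc])
  rw [hzero, smul_zero]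

/-- Two equal values `q i = q j` (`i ≠ j < t`) make `det Z_t(q) = 0`. [this work] -/
theorem det_zetaMat_eq_zero_of_eq (c q : ℕ → Finset (Fin k)) (t : ℕ) {i j : Fin t} (hij : i ≠ j)
    (hq : q i = q j) : ((Matrix.of fun (s : Fin (t)) (j : Fin (t)) => if c (s : ℕ) ⊆ (q) (j : ℕ) then (1 : ZMod 2) else 0)).det = 0 :=
  Matrix.det_zero_of_column_eq hij fun s => by simp [hq]

/-- **The chain (sequence form of `(SDR-chain)`).**  For an up-set `U ⊆ 2^[k]` enumerated along a linear extension
`c 0, …, c (m-1)` there are `p 0, …, p (m-1) ∈ U`, pairwise distinct, with `(c t)ᶜ ⊆ p t`, such that every prefix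
`c 0..c (t-1)` is matched into `p 0..p (t-1)` by a permutation `σ` with `c (σ j) ⊆ p j`. [this work] -/
theorem exists_chain (hup : ∀ ⦃x y : Finset (Fin k)⦄, x ∈ U → x ⊆ y → y ∈ U)
    (hmem : ∀ s < m, c s ∈ U) (hlin : ∀ s t, s < m → t < m → c t ⊆ c s → t ≤ s) :
    ∃ p : ℕ → Finset (Fin k), (∀ t < m, p t ∈ U) ∧ (∀ t < m, (c t)ᶜ ⊆ p t) ∧
      (∀ s t, s < m → t < m → p s = p t → s = t) ∧
      ∀ t ≤ m, ∃ σ : Equiv.Perm (Fin t), ∀ j : Fin t, c (σ j) ⊆ p j := by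
  obtain ⟨p, hp1, hp2⟩ := exists_gf2_chain hup hmem hlin
  refine ⟨p, fun t ht => (hp1 t ht).1, fun t ht => (hp1 t ht).2, fun s t hs ht hst => ?_, fun t ht => ?_⟩
  · by_contra hne
    have h0 := det_zetaMat_eq_zero_of_eq c p m (i := ⟨s, hs⟩) (j := ⟨t, ht⟩)
      (fun heq => hne (by simpa using congrArg Fin.val heq)) hst
    rw [hp2 m le_rfl] at h0
    exact one_ne_zero h0
  · exact exists_dominating_perm c p t (by rw [hp2 t ht]; exact one_ne_zero)

end chain

/-! ## Abel summation: the matching inequality of `M′` in sequence form -/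

/-- Discrete Abel summation: `a` antitone and nonnegative on `[0,m)`, all prefix sums of `b` nonnegative
`⟹ Σ_{t<m} a t · b t ≥ 0`. [folklore] -/
theorem abel_sum_nonneg : ∀ (m : ℕ) (a b : ℕ → ℝ), (∀ s t, s ≤ t → t < m → a t ≤ a s) → (∀ t < m, 0 ≤ a t) →
    (∀ t ≤ m, 0 ≤ ∑ j ∈ Finset.range t, b j) → 0 ≤ ∑ t ∈ Finset.range m, a t * b t := by
  intro m
  induction m with
  | zero => intro a b _ _ _; simp
  | succ m ih =>
    intro a b ha ha0 hb
    have hsplit : ∑ t ∈ Finset.range (m + 1), a t * b t =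
        ∑ t ∈ Finset.range m, (a t - a m) * b t + a m * ∑ t ∈ Finset.range (m + 1), b t := by
      rw [Finset.sum_range_succ, Finset.sum_range_succ (fun t => b t), mul_add, Finset.mul_sum]
      simp only [sub_mul, Finset.sum_sub_distrib]
      ring
    rw [hsplit]
    have h1 := ih (fun t => a t - a m) b
      (fun s t hst htm => by linarith [ha s t hst (Nat.lt_succ_of_lt htm)])
      (fun t ht => by linarith [ha t m (le_of_lt ht) (Nat.lt_succ_self m)])
      (fun t ht => hb t (Nat.le_succ_of_le ht))
    have h2 : 0 ≤ a m * ∑ t ∈ Finset.range (m + 1), b t :=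
      mul_nonneg (ha0 m (Nat.lt_succ_self m)) (hb (m + 1) le_rfl)
    linarith

/-- A dominating permutation of the prefix gives `Σ_{j<t} H (c j) ≤ Σ_{j<t} H (p j)` for monotone `H`. [this work] -/
theorem prefix_sum_le_of_perm {c p : ℕ → Finset (Fin k)} {t : ℕ} (σ : Equiv.Perm (Fin t))
    (hσ : ∀ j : Fin t, c (σ j) ⊆ p j) (H : Finset (Fin k) → ℝ) (hH : Monotone H) :
    ∑ j ∈ Finset.range t, H (c j) ≤ ∑ j ∈ Finset.range t, H (p j) := by
  rw [← Fin.sum_univ_eq_sum_range (fun j => H (c j)) t, ← Fin.sum_univ_eq_sum_range (fun j => H (p j)) t]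
  calc ∑ i : Fin t, H (c i) = ∑ i : Fin t, H (c (σ i)) := (Equiv.sum_comp σ (fun i : Fin t => H (c i))).symm
    _ ≤ ∑ i : Fin t, H (p i) := Finset.sum_le_sum fun i _ => hH (hσ i)

/-- **`M′` in sequence form.**  If every prefix of `c` is dominated by the corresponding prefix of `p`, then for `H` monotone and
weights `a t = F (c t)ᶜ` antitone and nonnegative in `t`:  `Σ_{t<m} a t · H (c t) ≤ Σ_{t<m} a t · H (p t)`. [this work] -/
theorem chain_sum_le {c p : ℕ → Finset (Fin k)} {m : ℕ}
    (hdom : ∀ t ≤ m, ∃ σ : Equiv.Perm (Fin t), ∀ j : Fin t, c (σ j) ⊆ p j)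
    (H : Finset (Fin k) → ℝ) (hH : Monotone H) (a : ℕ → ℝ)
    (ha : ∀ s t, s ≤ t → t < m → a t ≤ a s) (ha0 : ∀ t < m, 0 ≤ a t) :
    ∑ t ∈ Finset.range m, a t * H (c t) ≤ ∑ t ∈ Finset.range m, a t * H (p t) := by
  have key := abel_sum_nonneg m a (fun t => H (p t) - H (c t)) ha ha0 (fun t ht => by
    obtain ⟨σ, hσ⟩ := hdom t ht
    have := prefix_sum_le_of_perm σ hσ H hH
    rw [Finset.sum_sub_distrib]
    linarith)
  have : ∑ t ∈ Finset.range m, a t * (H (p t) - H (c t)) =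
      ∑ t ∈ Finset.range m, a t * H (p t) - ∑ t ∈ Finset.range m, a t * H (c t) := by
    rw [← Finset.sum_sub_distrib]
    exact Finset.sum_congr rfl fun t _ => by ring
  linarith

/-- **The matching lemma `M′` (sequence form, §4.30/§6 of the memo).**  For an up-set `U ⊆ 2^[k]` enumerated along a linear
extension `c`, there is a rearrangement `p` of covers — `p t ∈ U` pairwise distinct, `(c t)ᶜ ⊆ p t` — such that
`Σ_{t<m} a t · H (c t) ≤ Σ_{t<m} a t · H (p t)` for EVERY monotone `H` and EVERY antitone nonnegative weight `a`
(take `a t = F (c t)ᶜ` for `F ≥ 0` increasing and `c` chosen with `t ↦ F (c t)ᶜ` non-increasing). [this work] -/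
theorem exists_chain_matching {U : Finset (Finset (Fin k))} {c : ℕ → Finset (Fin k)} {m : ℕ}
    (hup : ∀ ⦃x y : Finset (Fin k)⦄, x ∈ U → x ⊆ y → y ∈ U)
    (hmem : ∀ s < m, c s ∈ U) (hlin : ∀ s t, s < m → t < m → c t ⊆ c s → t ≤ s) :
    ∃ p : ℕ → Finset (Fin k), (∀ t < m, p t ∈ U) ∧ (∀ t < m, (c t)ᶜ ⊆ p t) ∧
      (∀ s t, s < m → t < m → p s = p t → s = t) ∧
      ∀ (H : Finset (Fin k) → ℝ), Monotone H → ∀ (a : ℕ → ℝ), (∀ s t, s ≤ t → t < m → a t ≤ a s) →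
        (∀ t < m, 0 ≤ a t) → ∑ t ∈ Finset.range m, a t * H (c t) ≤ ∑ t ∈ Finset.range m, a t * H (p t) := by
  obtain ⟨p, hp1, hp2, hp3, hp4⟩ := exists_chain hup hmem hlin
  exact ⟨p, hp1, hp2, hp3, fun H hH a ha ha0 => chain_sum_le hp4 H hH a ha ha0⟩

end SahiSharedCube

end Summit.CriticalPhenomena.PercolationContinuityZ3.Theorems
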